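import Literature.Probability.RandomPlanarGeometry.HexSAWRotSurfaceArmchairDictionary
import Literature.Probability.RandomPlanarGeometry.HexSAWArmchairSqrtAsymptotic
import HarnessLib

/-!
# Beaton's rotated-frame limit `μ(y)`: `μ(y)/√y → 1` as `y → ∞` (the value form of rider «ARM-SQRT-ASYMPTOTIC»)

Topic `Literature/Probability/RandomPlanarGeometry` (lane «pcv-sawmu», rotated-door lineage; a corollary file: `HexSAWRotSurfaceArmchairDictionary.lean`
defines `HV.rotSurfaceMu y := max (armRate y) μ` — the value of Beaton's `μ(y) = lim_n C⁺_n(y)^{1/n}` (unconditionally by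
`HexSAWRotSurfaceYcLimitAllY.lean`, `HV.tendsto_rotHpCoeff_rpow`) — and `HexSAWArmchairSqrtAsymptotic.lean` proves
`1 ≤ β_rot(y)/√y ≤ 1/(1 − 109/√y)` (`y > 109²`) and `β_rot(y)/√y → 1` for the armchair wall-bridge rate `armRate y = β_rot(y)`).

Sources. N. R. Beaton, J. Phys. A 47 (2014) 075003 = arXiv:1210.0274v3, §3.1, Proposition 7 (p. 11: "`μ(y) := lim_{n→∞} C_n^+(y)^{1/n}` exists
and is finite … for any `y > 0`, `μ(y) ≥ max{μ, √y}`").  N. R. Beaton, M. Bousquet-Mélou, J. de Gier, H. Duminil-Copin, A. J. Guttmann, CMP 326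
(2014) = arXiv:1109.0358v5, §3.1 (p. 10: "on the square lattice, `μ(y)` is asymptotic to `y` [Rychlewski–Whittington 2011]. This translates into
`μ(y) ∼ √y` in our honeycomb setting" — the zig-zag boundary, no proof).  G. Rychlewski, S. G. Whittington, J. Stat. Phys. 145 (2011) 661–668 (not held).
H. Duminil-Copin, S. Smirnov, Ann. of Math. 175 (2012) 1653, Theorem 1 (`μ = √(2+√2)`).

What is proved (namespace `…SAW.HV`): `rotSurfaceMu_eq_armRate_of_four_le` (`y ≥ 4 ⇒ μ_rot(y) = β_rot(y)`, since `β_rot ≥ √y ≥ 2 > μ`),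
`one_le_rotSurfaceMu_div_sqrt`, **`rotSurfaceMu_le_sqrt_div (109² < y) : μ_rot(y) ≤ √y/(1 − 109/√y)`**, **`tendsto_rotSurfaceMu_div_sqrt :
μ_rot(y)/√y → 1`**, `tendsto_log_rotSurfaceMu_sub_half_log`.  Status in print: as in `HexSAWArmchairSqrtAsymptotic.lean` (lit-1 g16: NEW-IN-WRITING,
modest — the armchair-boundary analogue of Rychlewski–Whittington / of BBdGDCG's p. 10 remark).
-/

noncomputable section

open Filter
open Literature.Probability.RandomPlanarGeometry.SAW.HexBW.Arm
open _root_.Topology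

namespace Literature.Probability.RandomPlanarGeometry.SAW.HV

variable {y : ℝ}

/-- For `y ≥ 4` the maximum in `μ_rot(y) = max(β_rot(y), μ)` is the wall-bridge rate: `β_rot(y) ≥ √y ≥ 2 > μ = √(2+√2)`.
[cite: Beaton2014RotatedHoneycomb, Proposition 7 (arXiv v3 p. 11: "μ(y) ≥ max{μ, √y}"); DuminilCopinSmirnov2012, Theorem 1] -/
theorem rotSurfaceMu_eq_armRate_of_four_le (hy : 4 ≤ y) : rotSurfaceMu y = armRate y := by
  have hy0 : 0 < y := by linarith
  have h2 : (2 : ℝ) ≤ Real.sqrt y := by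
    rw [show (2 : ℝ) = Real.sqrt (2 ^ 2) by rw [Real.sqrt_sq (by norm_num)]]
    exact Real.sqrt_le_sqrt (by nlinarith)
  have hμ : hexConnectiveConstant ≤ armRate y := by
    have h1 := (one_le_armRate_div_sqrt hy0)
    rw [le_div_iff₀ (Real.sqrt_pos.2 hy0), one_mul] at h1
    linarith [hexConnectiveConstant_le.1]
  rw [rotSurfaceMu, max_eq_left hμ]

/-- **`1 ≤ μ_rot(y)/√y`** for `y > 0`. [cite: Beaton2014RotatedHoneycomb, Proposition 7 (arXiv v3 p. 11: "μ(y) ≥ max{μ, √y}")] -/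
theorem one_le_rotSurfaceMu_div_sqrt (hy : 0 < y) : 1 ≤ rotSurfaceMu y / Real.sqrt y :=
  (one_le_armRate_div_sqrt hy).trans (div_le_div_of_nonneg_right (armRate_le_rotSurfaceMu y) (Real.sqrt_nonneg y))

/-- **`μ_rot(y) ≤ √y / (1 − 109/√y)` for `y > 109²`.** [cite: Beaton2014RotatedHoneycomb, Proposition 7 (arXiv v3 p. 11); BeatonBousquetMelouDeGierDuminilCopinGuttmann2014, §3.1 (arXiv v5 p. 10: "This translates into μ(y) ∼ √y in our honeycomb setting", zig-zag boundary); RychlewskiWhittington2011, Theorem (hypercubic analogue; not held)] -/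
theorem rotSurfaceMu_le_sqrt_div (hy : (109 : ℝ) ^ 2 < y) : rotSurfaceMu y ≤ Real.sqrt y / (1 - 109 / Real.sqrt y) := by
  rw [rotSurfaceMu_eq_armRate_of_four_le (by linarith)]
  exact armRate_le_sqrt_div hy

/-- **`μ_rot(y)/√y ≤ 1/(1 − 109/√y)`** for `y > 109²`. [cite: Beaton2014RotatedHoneycomb, Proposition 7 (arXiv v3 p. 11)] -/
theorem rotSurfaceMu_div_sqrt_le (hy : (109 : ℝ) ^ 2 < y) : rotSurfaceMu y / Real.sqrt y ≤ 1 / (1 - 109 / Real.sqrt y) := by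
  rw [rotSurfaceMu_eq_armRate_of_four_le (by linarith)]
  exact armRate_div_sqrt_le hy

/-- **Beaton's `μ(y)` satisfies `μ(y)/√y → 1` as `y → ∞`** (value form; `μ(y) = lim_n C⁺_n(y)^{1/n} = μ_rot(y)` by `HexSAWRotSurfaceYcLimitAllY.lean`):
the adsorbed phase of the rotated model carries no residual entropy at leading order. [cite: Beaton2014RotatedHoneycomb, Proposition 7 (arXiv v3 p. 11: "μ(y) ≥ max{μ, √y}" — here with the matching upper bound); BeatonBousquetMelouDeGierDuminilCopinGuttmann2014, §3.1 (arXiv v5 p. 10: "This translates into μ(y) ∼ √y in our honeycomb setting")] -/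
theorem tendsto_rotSurfaceMu_div_sqrt : Tendsto (fun y : ℝ => rotSurfaceMu y / Real.sqrt y) atTop (𝓝 1) := by
  refine tendsto_armRate_div_sqrt.congr' ?_
  filter_upwards [eventually_ge_atTop (4 : ℝ)] with y hy
  rw [rotSurfaceMu_eq_armRate_of_four_le hy]

/-- **`log μ_rot(y) − ½ log y → 0`.** [cite: Beaton2014RotatedHoneycomb, Proposition 7 (arXiv v3 p. 11)] -/
theorem tendsto_log_rotSurfaceMu_sub_half_log : Tendsto (fun y : ℝ => Real.log (rotSurfaceMu y) - Real.log y / 2) atTop (𝓝 0) := by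
  refine tendsto_log_armRate_sub_half_log.congr' ?_
  filter_upwards [eventually_ge_atTop (4 : ℝ)] with y hy
  rw [rotSurfaceMu_eq_armRate_of_four_le hy]

end Literature.Probability.RandomPlanarGeometry.SAW.HV
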